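import Literature.MathematicalPhysics.QuantumLattice.SpinHalfCasimirBound
import Literature.MathematicalPhysics.QuantumLattice.XYOrderGDProofs
import Literature.MathematicalPhysics.QuantumLattice.HeisenbergOrderNeelProofs
import HarnessLib

/-!
# Anderson's cluster lower bounds for ground-state energies: the spin-½ XY star

Trunk T-QLATTICE. P. W. Anderson's argument (Phys. Rev. 83 (1951) 1260): write a lattice
Hamiltonian as a positive combination of CLUSTER Hamiltonians, `H = Σ_c H_c`; then
`E₀(H) ≥ Σ_c E₀(H_c)` (`Matrix.groundEnergy_sum_ge`), and each `E₀(H_c)` is a few-spin number.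
With the STAR clusters (a site and its `k` neighbours; every bond lies in exactly two stars) the
few-spin numbers are in closed form, as OPERATOR inequalities inside any finite spin-½ system:

* **XY star** `T = Σ_{y∈Y} (Sˣ_xSˣ_y + Sʸ_xSʸ_y)` (`x ∉ Y`, `|Y| = k`):
  `T² = ¼Σ_α(L^α)² - ¼(L^z + Sᶻ_x)² + 1/16` (`xyStar_mul_self`), hence with the Casimir bound
  `𝐋² ≤ k(k+2)/4` (`SpinHalfCasimirBound.lean`): `T² ≤ (k+1)²/16` and, when `k` is even (the
  `k + 1` spins of the star then have half-odd total `S^z`, `(L^z+Sᶻ_x)² ≥ ¼`), the sharp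
  `T² ≤ k(k+2)/16`; so every eigenvalue of `±T` is `≥ -√(k(k+2))/4` (`= -√6/2` for `k = 4`).
* (Heisenberg star `G = 𝐒_x·𝐋`: `G² = ¼Σ_α(L^α)² - ½G`, eigenvalues `≥ -(k+2)/4` — Anderson's
  `-½S(zS+1)`; not in this file.)

This file: the variational lemmas `Matrix.groundEnergy_sum_ge`, `Matrix.neg_sqrt_le_groundEnergy_of_sq_le`,
the commutators of the set spin (`setSpin_one_x_mul_y_sub` …), the XY star identity and bound
(`xyStar_mul_self`, `posSemidef_xyStar_bound`, `neg_xyStar_groundEnergy_ge`, constant `(k+1)/4`).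
The torus corollary `E₀(xyTorus d L 1) ≥ -((2d+1)/8)·L^d` is `AndersonXYTorusBound.lean`; the
Heisenberg star and the sharp even-`k` constants are left to a sibling file. No definition is
introduced.

## References

* [Anderson1951] P. W. Anderson, *Limits on the energy of the antiferromagnetic ground state*,
  Phys. Rev. 83 (1951) 1260.
* [Tasaki2020] H. Tasaki, *Physics and Mathematics of Quantum Many-Body Systems* (2020), §2.1–2.5,
  App. A.3.
-/

noncomputable section

open Matrix Complex Finset
open scoped ComplexOrder

namespace Matrix

variable {m : Type*} [Fintype m] [DecidableEq m]

/-- **Superadditivity of the ground-state energy** (the variational principle):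
`E₀(Σᵢ Aᵢ) ≥ Σᵢ E₀(Aᵢ)` for Hermitian `Aᵢ` — the input of every cluster (Anderson) bound.
[cite: Anderson1951] -/
theorem groundEnergy_sum_ge [Nonempty m] {ι : Type*} (s : Finset ι) {A : ι → Matrix m m ℂ}
    (hA : ∀ i ∈ s, (A i).IsHermitian) :
    ∑ i ∈ s, (A i).groundEnergy ≤ (∑ i ∈ s, A i).groundEnergy := by
  have hH : (∑ i ∈ s, A i).IsHermitian := by
    rw [IsHermitian, conjTranspose_sum]
    exact Finset.sum_congr rfl fun i hi => (hA i hi).eq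
  obtain ⟨ψ, hψ1, hψE⟩ := exists_groundState_unit hH
  rw [← hψE, Matrix.sum_mulVec, dotProduct_sum, Complex.re_sum]
  exact Finset.sum_le_sum fun i hi =>
    groundEnergy_le_rayleigh_holds (hA i hi) ψ hψ1

/-- **Eigenvalue bound from a square bound**: if `A` is Hermitian and `C·1 - A² ⪰ 0` (`C ≥ 0`)
then `E₀(A) ≥ -√C` (a ground vector `ψ` has `‖Aψ‖² = E₀² ≤ C`; for `C < 0` the hypothesis is
void and `√C = 0`). [folklore] -/
theorem neg_sqrt_le_groundEnergy_of_sq_le [Nonempty m] {A : Matrix m m ℂ} (hA : A.IsHermitian)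
    {C : ℝ} (h : ((C : ℂ) • (1 : Matrix m m ℂ) - A * A).PosSemidef) :
    -Real.sqrt C ≤ A.groundEnergy := by
  obtain ⟨ψ, hψ1, hψE⟩ := exists_groundState_unit hA
  have hmem : ψ ∈ A.groundSpace :=
    (rayleigh_eq_groundEnergy_iff_holds hA ψ hψ1).1 hψE
  have hAψ : A *ᵥ ψ = (A.groundEnergy : ℂ) • ψ :=
    (mem_groundSpace_iff A ψ).1 hmem
  -- `⟨ψ, (C - A²) ψ⟩ = C - E₀² ≥ 0`
  have hq := h.dotProduct_mulVec_nonneg ψ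
  rw [sub_mulVec, smul_mulVec, one_mulVec, ← mulVec_mulVec, hAψ, mulVec_smul, hAψ, smul_smul,
    dotProduct_sub, dotProduct_smul, dotProduct_smul, hψ1, smul_eq_mul, mul_one, smul_eq_mul,
    mul_one] at hq
  obtain ⟨hre, -⟩ := Complex.nonneg_iff.mp hq
  rw [Complex.sub_re, Complex.ofReal_re, ← Complex.ofReal_mul, Complex.ofReal_re] at hre
  -- `E₀² ≤ C`
  have hsq : A.groundEnergy ^ 2 ≤ C := by nlinarith
  have habs : |A.groundEnergy| ≤ Real.sqrt C := by
    rw [← Real.sqrt_sq_eq_abs]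
    exact Real.sqrt_le_sqrt hsq
  exact neg_le_of_abs_le habs

end Matrix

namespace Literature.MathematicalPhysics.QuantumLattice

variable {Λ : Type*} [Fintype Λ] [DecidableEq Λ]

/-! ### Commutators of the set spin `𝐋 = Σ_{y∈Y} 𝐒_y` (spin ½) -/

section SetSpin

/-- `Σ_{y,y'∈Y} (Sᵅ_y Sᵝ_{y'} - Sᵝ_{y'} Sᵅ_y) = Σ_{y∈Y} (Sᵅ_ySᵝ_y - Sᵝ_ySᵅ_y)`: distinct sites
commute. [folklore] -/
theorem setSpin_commutator_eq_sum_diag (n : ℕ) (Y : Finset Λ) (α β : Fin 3) :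
    (∑ y ∈ Y, siteSpin n y α : Op Λ (n + 1)) * (∑ y ∈ Y, siteSpin n y β) -
        (∑ y ∈ Y, siteSpin n y β) * (∑ y ∈ Y, siteSpin n y α) =
      ∑ y ∈ Y, (siteSpin n y α * siteSpin n y β - siteSpin n y β * siteSpin n y α) := by
  rw [Finset.sum_mul_sum, Finset.sum_mul_sum, Finset.sum_comm (s := Y) (t := Y)
    (f := fun y y' => siteSpin n y β * siteSpin n y' α), ← Finset.sum_sub_distrib]
  refine Finset.sum_congr rfl fun y hy => ?_
  rw [← Finset.sum_sub_distrib, ← Finset.add_sum_erase Y _ hy]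
  rw [Finset.sum_eq_zero, add_zero]
  intro y' hy'
  rw [(siteSpin_commute_of_ne_holds n (Finset.ne_of_mem_erase hy') β α).eq, sub_self]

/-- **`[Lˣ, Lʸ] = i Lᶻ`** for spins ½ on a finite set. Tasaki (2020) §2.2, eq. (2.2.11).
[cite: Tasaki2020] -/
theorem setSpin_one_x_mul_y_sub (Y : Finset Λ) :
    (∑ y ∈ Y, siteSpin 1 y 0 : Op Λ 2) * (∑ y ∈ Y, siteSpin 1 y 1) -
        (∑ y ∈ Y, siteSpin 1 y 1) * (∑ y ∈ Y, siteSpin 1 y 0) =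
      I • ∑ y ∈ Y, siteSpin 1 y 2 := by
  rw [setSpin_commutator_eq_sum_diag, Finset.smul_sum]
  refine Finset.sum_congr rfl fun y _ => ?_
  rw [siteSpin_one_x_mul_y, siteSpin_one_y_mul_x, sub_neg_eq_add, ← add_smul]
  congr 1
  ring

/-- `[Lʸ, Lᶻ] = i Lˣ` for spins ½ on a finite set. [cite: Tasaki2020] -/
theorem setSpin_one_y_mul_z_sub (Y : Finset Λ) :
    (∑ y ∈ Y, siteSpin 1 y 1 : Op Λ 2) * (∑ y ∈ Y, siteSpin 1 y 2) -
        (∑ y ∈ Y, siteSpin 1 y 2) * (∑ y ∈ Y, siteSpin 1 y 1) =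
      I • ∑ y ∈ Y, siteSpin 1 y 0 := by
  rw [setSpin_commutator_eq_sum_diag, Finset.smul_sum]
  refine Finset.sum_congr rfl fun y _ => ?_
  rw [siteSpin_one_y_mul_z, siteSpin_one_z_mul_y, sub_neg_eq_add, ← add_smul]
  congr 1
  ring

/-- `[Lᶻ, Lˣ] = i Lʸ` for spins ½ on a finite set. [cite: Tasaki2020] -/
theorem setSpin_one_z_mul_x_sub (Y : Finset Λ) :
    (∑ y ∈ Y, siteSpin 1 y 2 : Op Λ 2) * (∑ y ∈ Y, siteSpin 1 y 0) -
        (∑ y ∈ Y, siteSpin 1 y 0) * (∑ y ∈ Y, siteSpin 1 y 2) =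
      I • ∑ y ∈ Y, siteSpin 1 y 1 := by
  rw [setSpin_commutator_eq_sum_diag, Finset.smul_sum]
  refine Finset.sum_congr rfl fun y _ => ?_
  rw [siteSpin_one_z_mul_x, siteSpin_one_x_mul_z, sub_neg_eq_add, ← add_smul]
  congr 1
  ring

/-- A spin outside the set commutes with the set spin. [folklore] -/
theorem siteSpin_commute_setSpin (n : ℕ) {x : Λ} {Y : Finset Λ} (hx : x ∉ Y) (α β : Fin 3) :
    Commute (siteSpin n x α : Op Λ (n + 1)) (∑ y ∈ Y, siteSpin n y β) :=
  Commute.sum_right _ _ _ fun _ hy =>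
    siteSpin_commute_of_ne_holds n (ne_of_mem_of_not_mem hy hx).symm α β

end SetSpin

/-! ### The XY star -/

section XYStar

/-- **The square of the XY star operator.** For `x ∉ Y` and
`T = Σ_{y∈Y} (Sˣ_xSˣ_y + Sʸ_xSʸ_y) = Sˣ_xLˣ + Sʸ_xLʸ` (spin ½):
`T² = ¼((Lˣ)² + (Lʸ)²) - ½ Sᶻ_xLᶻ` — from `(Sˣ)² = (Sʸ)² = ¼`, `SˣSʸ = (i/2)Sᶻ = -SʸSˣ` at
`x` and `[Lˣ, Lʸ] = iLᶻ`. [cite: Anderson1951] -/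
theorem xyStar_mul_self {x : Λ} {Y : Finset Λ} (hx : x ∉ Y) :
    ((∑ y ∈ Y, (siteSpin 1 x 0 * siteSpin 1 y 0 + siteSpin 1 x 1 * siteSpin 1 y 1) : Op Λ 2) *
        ∑ y ∈ Y, (siteSpin 1 x 0 * siteSpin 1 y 0 + siteSpin 1 x 1 * siteSpin 1 y 1)) =
      (1 / 4 : ℂ) • ((∑ y ∈ Y, siteSpin 1 y 0) * (∑ y ∈ Y, siteSpin 1 y 0) +
          (∑ y ∈ Y, siteSpin 1 y 1) * (∑ y ∈ Y, siteSpin 1 y 1)) -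
        (1 / 2 : ℂ) • (siteSpin 1 x 2 * ∑ y ∈ Y, siteSpin 1 y 2) := by
  set Lx : Op Λ 2 := ∑ y ∈ Y, siteSpin 1 y 0 with hLx
  set Ly : Op Λ 2 := ∑ y ∈ Y, siteSpin 1 y 1 with hLy
  set Lz : Op Λ 2 := ∑ y ∈ Y, siteSpin 1 y 2 with hLz
  have hT : (∑ y ∈ Y, (siteSpin 1 x 0 * siteSpin 1 y 0 + siteSpin 1 x 1 * siteSpin 1 y 1) : Op Λ 2) =
      siteSpin 1 x 0 * Lx + siteSpin 1 x 1 * Ly := by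
    rw [hLx, hLy, Finset.mul_sum, Finset.mul_sum, ← Finset.sum_add_distrib]
  rw [hT]
  have cxx := (siteSpin_commute_setSpin 1 hx 0 0).eq  -- `S_x^x Lx = Lx S_x^x`
  have cyx := (siteSpin_commute_setSpin 1 hx 1 0).eq
  have cxy := (siteSpin_commute_setSpin 1 hx 0 1).eq
  have cyy := (siteSpin_commute_setSpin 1 hx 1 1).eq
  -- expand `(aLx + bLy)²` and move the site operators to the left
  have e1 : siteSpin 1 x 0 * Lx * (siteSpin 1 x 0 * Lx) = (1 / 4 : ℂ) • (Lx * Lx) := by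
    rw [Matrix.mul_assoc, ← Matrix.mul_assoc Lx, ← cxx, Matrix.mul_assoc, ← Matrix.mul_assoc,
      siteSpin_one_mul_self, Matrix.smul_mul, Matrix.one_mul]
  have e2 : siteSpin 1 x 1 * Ly * (siteSpin 1 x 1 * Ly) = (1 / 4 : ℂ) • (Ly * Ly) := by
    rw [Matrix.mul_assoc, ← Matrix.mul_assoc Ly, ← cyy, Matrix.mul_assoc, ← Matrix.mul_assoc,
      siteSpin_one_mul_self, Matrix.smul_mul, Matrix.one_mul]
  have e3 : siteSpin 1 x 0 * Lx * (siteSpin 1 x 1 * Ly) = (I / 2) • (siteSpin 1 x 2 * (Lx * Ly)) := by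
    rw [Matrix.mul_assoc, ← Matrix.mul_assoc Lx, ← cyx, Matrix.mul_assoc, ← Matrix.mul_assoc,
      siteSpin_one_x_mul_y, Matrix.smul_mul]
  have e4 : siteSpin 1 x 1 * Ly * (siteSpin 1 x 0 * Lx) = -((I / 2) • (siteSpin 1 x 2 * (Ly * Lx))) := by
    rw [Matrix.mul_assoc, ← Matrix.mul_assoc Ly, ← cxy, Matrix.mul_assoc, ← Matrix.mul_assoc,
      siteSpin_one_y_mul_x, Matrix.neg_mul, Matrix.smul_mul]
  rw [Matrix.add_mul, Matrix.mul_add, Matrix.mul_add, e1, e2, e3, e4]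
  -- the cross terms: `(i/2) S_x^z (LxLy - LyLx) = (i/2) S_x^z (i Lz) = -½ S_x^z Lz`
  have hcomm : Lx * Ly - Ly * Lx = I • Lz := setSpin_one_x_mul_y_sub Y
  have hcross : (I / 2) • (siteSpin 1 x 2 * (Lx * Ly)) + -((I / 2) • (siteSpin 1 x 2 * (Ly * Lx))) =
      -((1 / 2 : ℂ) • (siteSpin 1 x 2 * Lz)) := by
    rw [← sub_eq_add_neg, ← smul_sub, ← Matrix.mul_sub, hcomm, Matrix.mul_smul, smul_smul]
    rw [show I / 2 * I = -(1 / 2 : ℂ) by rw [div_mul_eq_mul_div, I_mul_I]; ring, neg_smul]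
  rw [smul_add]
  calc (1 / 4 : ℂ) • (Lx * Lx) + (I / 2) • (siteSpin 1 x 2 * (Lx * Ly)) +
        (-((I / 2) • (siteSpin 1 x 2 * (Ly * Lx))) + (1 / 4 : ℂ) • (Ly * Ly))
      = (1 / 4 : ℂ) • (Lx * Lx) + (1 / 4 : ℂ) • (Ly * Ly) +
          ((I / 2) • (siteSpin 1 x 2 * (Lx * Ly)) + -((I / 2) • (siteSpin 1 x 2 * (Ly * Lx)))) := by
        abel
    _ = (1 / 4 : ℂ) • (Lx * Lx) + (1 / 4 : ℂ) • (Ly * Ly) - (1 / 2 : ℂ) • (siteSpin 1 x 2 * Lz) := by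
        rw [hcross, ← sub_eq_add_neg]


/-- **The XY star bound** (spin ½, `x ∉ Y`, `k = |Y|`): `T² ≤ (k+1)²/16`, i.e.
`((k+1)²/16)·1 - T² = ¼[(k(k+2)/4)·1 - 𝐋²] + ¼(Lᶻ + Sᶻ_x)² ⪰ 0`, with `T = Σ_{y∈Y}(Sˣ_xSˣ_y + Sʸ_xSʸ_y)`.
(The sharp constant `k(k+2)/16` holds for even `k`; not proved here.)
[cite: Anderson1951] -/
theorem posSemidef_xyStar_bound {x : Λ} {Y : Finset Λ} (hx : x ∉ Y) :
    (((((Y.card : ℂ) + 1) ^ 2 / 16) • (1 : Op Λ 2)) -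
      (∑ y ∈ Y, (siteSpin 1 x 0 * siteSpin 1 y 0 + siteSpin 1 x 1 * siteSpin 1 y 1)) *
        ∑ y ∈ Y, (siteSpin 1 x 0 * siteSpin 1 y 0 + siteSpin 1 x 1 * siteSpin 1 y 1)).PosSemidef := by
  set Lx : Op Λ 2 := ∑ y ∈ Y, siteSpin 1 y 0 with hLx
  set Ly : Op Λ 2 := ∑ y ∈ Y, siteSpin 1 y 1 with hLy
  set Lz : Op Λ 2 := ∑ y ∈ Y, siteSpin 1 y 2 with hLz
  set S : Op Λ 2 := siteSpin 1 x 2 with hS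
  set J : Op Λ 2 := Lz + S with hJ
  rw [xyStar_mul_self hx]
  -- the Casimir gap and the square `J²`
  have hgap := posSemidef_casimirBound_sub (Λ := Λ) Y
  rw [Fin.sum_univ_three] at hgap
  have hJh : J.IsHermitian := by
    rw [hJ, hLz, hS]
    refine Matrix.IsHermitian.add ?_ (siteSpin_isHermitian 1 x 2)
    rw [IsHermitian, conjTranspose_sum]
    exact Finset.sum_congr rfl fun y _ => (siteSpin_isHermitian 1 y 2).eq
  have hJsq : (J * J).PosSemidef := by
    have := posSemidef_conjTranspose_mul_self J
    rwa [hJh.eq] at this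
  have hSLz : S * Lz = Lz * S := (siteSpin_commute_setSpin 1 hx 2 2).eq
  have hJJ : J * J = Lz * Lz + (2 : ℂ) • (S * Lz) + (1 / 4 : ℂ) • 1 := by
    rw [hJ, Matrix.add_mul, Matrix.mul_add, Matrix.mul_add, hS, siteSpin_one_mul_self, ← hS, hSLz,
      two_smul]
    abel
  -- the identity
  have key : ((((Y.card : ℂ) + 1) ^ 2 / 16) • (1 : Op Λ 2)) -
      ((1 / 4 : ℂ) • (Lx * Lx + Ly * Ly) - (1 / 2 : ℂ) • (S * Lz)) =
      (1 / 4 : ℂ) • ((((Y.card : ℂ) * (Y.card + 2) / 4) • (1 : Op Λ 2)) -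
        (Lx * Lx + Ly * Ly + Lz * Lz)) + (1 / 4 : ℂ) • (J * J) := by
    rw [hJJ]
    simp only [smul_add, smul_sub, smul_smul]
    rw [show (1 / 4 : ℂ) * ((Y.card : ℂ) * (Y.card + 2) / 4) = ((Y.card : ℂ) + 1) ^ 2 / 16 - 1 / 16 by ring]
    rw [sub_smul]
    norm_num
    abel
  rw [key]
  have h14 : (0 : ℂ) ≤ 1 / 4 := by
    rw [show (1 / 4 : ℂ) = ((1 / 4 : ℝ) : ℂ) by norm_num]
    exact Complex.zero_le_real.2 (by norm_num)
  exact Matrix.PosSemidef.add (hgap.smul h14) (hJsq.smul h14)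

/-- **Anderson's XY star energy bound** (spin ½, `x ∉ Y`, `k = |Y|`): every eigenvalue of
`-Σ_{y∈Y}(Sˣ_xSˣ_y + Sʸ_xSʸ_y)` — the ferromagnetic XY coupling of a site to `k` neighbours —
is at least `-(k+1)/4`; in particular its ground energy is. [cite: Anderson1951] -/
theorem neg_xyStar_groundEnergy_ge [Nonempty Λ] {x : Λ} {Y : Finset Λ} (hx : x ∉ Y) :
    -(((Y.card : ℝ) + 1) / 4) ≤
      (-(∑ y ∈ Y, (siteSpin 1 x 0 * siteSpin 1 y 0 + siteSpin 1 x 1 * siteSpin 1 y 1)) :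
        Op Λ 2).groundEnergy := by
  haveI : Nonempty (TensorIndex Λ 2) := ⟨fun _ => 0⟩
  set T : Op Λ 2 := ∑ y ∈ Y, (siteSpin 1 x 0 * siteSpin 1 y 0 + siteSpin 1 x 1 * siteSpin 1 y 1)
    with hT
  have hTh : T.IsHermitian := by
    rw [hT, IsHermitian, conjTranspose_sum]
    refine Finset.sum_congr rfl fun y hy => ?_
    have hxy : x ≠ y := (ne_of_mem_of_not_mem hy hx).symm
    rw [conjTranspose_add, conjTranspose_mul, conjTranspose_mul, (siteSpin_isHermitian 1 x 0).eq,
      (siteSpin_isHermitian 1 y 0).eq, (siteSpin_isHermitian 1 x 1).eq, (siteSpin_isHermitian 1 y 1).eq,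
      (siteSpin_commute_of_ne_holds 1 hxy 0 0).eq, (siteSpin_commute_of_ne_holds 1 hxy 1 1).eq]
  have hsq : (((((Y.card : ℝ) + 1) / 4) ^ 2 : ℝ) : ℂ) • (1 : Op Λ 2) - (-T) * (-T) =
      ((((Y.card : ℂ) + 1) ^ 2 / 16) • (1 : Op Λ 2)) - T * T := by
    rw [neg_mul_neg]
    congr 2
    push_cast
    ring
  have hpsd : ((((((Y.card : ℝ) + 1) / 4) ^ 2 : ℝ) : ℂ) • (1 : Op Λ 2) - (-T) * (-T)).PosSemidef := by
    rw [hsq]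
    exact posSemidef_xyStar_bound hx
  have h := Matrix.neg_sqrt_le_groundEnergy_of_sq_le hTh.neg hpsd
  rwa [Real.sqrt_sq (by positivity)] at h


end XYStar

end Literature.MathematicalPhysics.QuantumLattice
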